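import Literature.AlgebraicGeometry.ModuliOfAbelianVarieties.SiegelFamilyIsomorphicToConjugateNotReal
import Literature.Geometry.Kaehler.ComplexTorusOddDimensionRealStructure
import HarnessLib

/-!
# Shimura's Theorem 1 in the Siegel family: in ODD genus a principally polarized torus `X_Z` with
# `End(X_Z)^* = {±1}` that is isomorphic to its conjugate `X_{−Z̄}` has a real structure
# (Shimura 1972, Thm. 1; contrast §3 Thm. 2 in even genus)

Topic `Literature/AlgebraicGeometry/ModuliOfAbelianVarieties` (the Siegel-family files, namespace
`Literature.AlgebraicGeometry.ModuliOfAbelianVarieties.SiegelModuli`).  Lane `lit-hodgefound`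
(Track 2 foundations library), prover seat p15 generation 49, row g49-#5: the Siegel-family reading of
g49-#4 `ComplexTorusOddDimensionRealStructure` (odd dimension, `End(X)^* = {±1}`, `X ≅ X̄` ⟹ real
structure; anti-holomorphic lattice automorphisms never square to `−1`), on top of g48-#1
`SiegelFamilyIsomorphicToConjugateNotReal` (`X_{−Z̄}` IS the conjugate torus of `X_Z`: every conjugate
presentation of `X_Z` is isomorphic to `X_{−Z̄}`).  In EVEN genus the tree has Shimura's Theorem 2
(g48-#6, g49-#1/#2: points `Z ∈ 𝔜_j` with `(X_Z, E_Z) ≅ (X_{−Z̄}, E_{−Z̄})`, `End(X_Z) = ℤ`, and NO real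
structure); THIS FILE records that in ODD genus this cannot happen.  THEOREMS ONLY: no definition, no
instance, no notation, no named fact (net Literature debt `0`), no `sorry`.

## Source, VERBATIM

G. Shimura, *On the field of rationality for an abelian variety*, Nagoya Math. J. **45** (1972) 167–178,
held `paper:doi-10-1017-s0027763000014720`: p. 167 «(I) Every generic polarized abelian variety of odd
dimension has a model rational over its field of moduli. (II) No generic principally polarized abelian
variety of even dimension has a model rational over its field of moduli.»; p. 173 «**THEOREM 1.** Every
generic polarized abelian variety of odd dimension has a model rational over its field of moduli.»;
p. 174 «§3. The even dimensional case … Now we assume that `n` is even»; p. 176 «**PROPOSITION 12.** If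
`P_z`, with `z ∈ 𝔜`, has no automorphisms other than `±1`, then `P_z` has no model rational over its
field of moduli.  Proof. Since `P_z` is isomorphic to `P_z^ρ`, the field of moduli of `P_z` is contained
in `ℝ`. …»

## The tree's rendering (principal type, `X_Z = ℂ^g/(Z, 1)ℤ^{2g}`, `Z ∈ 𝔥_g`)

As in g44/g48/g49-#4: «generic» ⟹ `End(X_Z)^* = {±1}` (the hypothesis used); «field of moduli `⊂ ℝ`»
at the archimedean place = «`X_Z ≅ X_Z^ρ = X_{−Z̄}`»; «model rational over `ℝ`» = «real structure».

* `isIsomorphic_negConj_of_realStructure` — every genus: a real structure on `X_Z` makes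
  `X_Z ≅ X_{−Z̄}` (g43-#4 + g48-#1; the direction «model over `ℝ` ⟹ field of moduli `⊂ ℝ`»).
* **`nonempty_realStructure_of_isIsomorphic_negConj_of_odd`** — THEOREM 1 in the family: `g` odd,
  `End(X_Z)^* = {±1}`, `X_Z ≅ X_{−Z̄}` as complex tori ⟹ `X_Z` has a real structure; the polarized form
  `nonempty_realStructure_of_isPolarizedIso_negConj_of_odd` (`(X_Z, E_Z) ≅ (X_{−Z̄}, E_{−Z̄})` suffices);
  and the iff `nonempty_realStructure_iff_isIsomorphic_negConj_of_odd`.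
* `mul_self_eq_one_of_anticomm_siegel_of_odd` — `g` odd, `End(X_Z)^* = {±1}`: every integral `T`
  invertible over `ℤ` with `T_ℝ J_Z = −J_Z T_ℝ` satisfies `T² = 1` (no `λ^ρ ∘ λ = −1` in odd genus).
-/

noncomputable section

open scoped Manifold Matrix ComplexConjugate
open Matrix Complex Function

namespace Literature.AlgebraicGeometry.ModuliOfAbelianVarieties

namespace SiegelModuli

open Literature.NumberTheory.Automorphic (siegelUpperHalfSpace)
open Literature.Geometry.Kaehler Literature.Geometry.Kaehler.ComplexTorus

variable {g : ℕ} (hδ : ∀ i, 0 < (1 : Fin g → ℕ) i) {Z : Matrix (Fin g) (Fin g) ℂ}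
  (hZ : Z ∈ siegelUpperHalfSpace g)

/-- **A real `X_Z` is isomorphic to its conjugate `X_{−Z̄}`** (every genus): a real structure makes
`X_Z` isomorphic to each conjugate presentation (g43-#4), and these are isomorphic to `X_{−Z̄}` (g48-#1)
— «model over `ℝ` ⟹ field of moduli `⊂ ℝ`». [cite: Shimura1972FieldOfRationality, §3 Prop. 12 proof («Since `P_z` is isomorphic to `P_z^ρ`, the field of moduli of `P_z` is contained in `ℝ`»), p. 176] [cite: Silhol1989, Ch. I (1.3), pp. 2–3] -/
theorem isIsomorphic_negConj_of_realStructure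
    (S : RealStructure 𝓘(ℂ, Fin g → ℂ) (ComplexTorus (siegelPeriodEquiv hδ hZ))) :
    IsIsomorphic (siegelPeriodEquiv hδ hZ) (siegelPeriodEquiv hδ (neg_map_conj_mem_siegelUpperHalfSpace hZ)) := by
  obtain ⟨Ψc, hΨ, hiso⟩ := exists_isIsomorphic_conj_of_realStructure S
  exact hiso.trans (isIsomorphic_conj_presentation hδ hZ (neg_map_conj_mem_siegelUpperHalfSpace hZ) rfl hΨ)

/-- **THEOREM 1 in the Siegel family (odd genus).**  Let `g` be odd, `Z ∈ 𝔥_g`, and suppose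
`End(X_Z)^* = {±1}` (every holomorphic `ρ(P)` with `P` invertible over `ℤ` is `±1`).  If `X_Z ≅ X_{−Z̄}`
as complex tori, then `X_Z` carries a real structure («Every generic polarized abelian variety of odd
dimension has a model rational over its field of moduli»).  In even genus this fails on Shimura's locus
`𝔜` (g48-#6, g49-#1). [cite: Shimura1972FieldOfRationality, Thm. 1, p. 173, and Introduction (I)–(II), p. 167] -/
theorem nonempty_realStructure_of_isIsomorphic_negConj_of_odd (hodd : Odd g)
    (hEnd : ∀ P : Matrix (Fin g ⊕ Fin g) (Fin g ⊕ Fin g) ℤ,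
      MDifferentiable 𝓘(ℂ, Fin g → ℂ) 𝓘(ℂ, Fin g → ℂ)
          (mapMatrix (siegelPeriodEquiv hδ hZ) (siegelPeriodEquiv hδ hZ) P) →
        (∃ Q : Matrix (Fin g ⊕ Fin g) (Fin g ⊕ Fin g) ℤ, P * Q = 1 ∧ Q * P = 1) → P = 1 ∨ P = -1)
    (hiso : IsIsomorphic (siegelPeriodEquiv hδ hZ)
      (siegelPeriodEquiv hδ (neg_map_conj_mem_siegelUpperHalfSpace hZ))) :
    Nonempty (RealStructure 𝓘(ℂ, Fin g → ℂ) (ComplexTorus (siegelPeriodEquiv hδ hZ))) := by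
  have hg : 0 < g := hodd.pos
  haveI : Nonempty (Fin g ⊕ Fin g) := ⟨Sum.inl ⟨0, hg⟩⟩
  have hodd' : Odd (Module.finrank ℂ (Fin g → ℂ)) := by rwa [Module.finrank_fin_fun]
  obtain ⟨Ψc, hΨ⟩ := exists_conj_presentation_finrank (siegelPeriodEquiv hδ hZ)
  have hiso' : IsIsomorphic (siegelPeriodEquiv hδ hZ) Ψc :=
    hiso.trans (isIsomorphic_conj_presentation hδ hZ (neg_map_conj_mem_siegelUpperHalfSpace hZ) rfl hΨ).symm
  exact nonempty_realStructure_of_isIsomorphic_conj_of_odd hodd' hEnd hΨ hiso'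

/-- **Polarized form**: in odd genus, with `End(X_Z)^* = {±1}`, an isomorphism of principally polarized
tori `(X_Z, E_Z) ≅ (X_{−Z̄}, E_{−Z̄})` (Shimura's `λ : P_z ⥲ P_z^ρ`) already forces a real structure on
`X_Z` — whereas on `𝔜 ⊂ 𝔥_{2m}` such a `λ` exists with `λ^ρ ∘ λ = −1` and no real structure (Prop. 10,
Prop. 12). [cite: Shimura1972FieldOfRationality, Thm. 1, p. 173; §3 Prop. 10 and Prop. 12, pp. 174–176] -/
theorem nonempty_realStructure_of_isPolarizedIso_negConj_of_odd (hodd : Odd g)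
    (hEnd : ∀ P : Matrix (Fin g ⊕ Fin g) (Fin g ⊕ Fin g) ℤ,
      MDifferentiable 𝓘(ℂ, Fin g → ℂ) 𝓘(ℂ, Fin g → ℂ)
          (mapMatrix (siegelPeriodEquiv hδ hZ) (siegelPeriodEquiv hδ hZ) P) →
        (∃ Q : Matrix (Fin g ⊕ Fin g) (Fin g ⊕ Fin g) ℤ, P * Q = 1 ∧ Q * P = 1) → P = 1 ∨ P = -1)
    {h : ComplexTorus (siegelPeriodEquiv hδ hZ) ≃+
      ComplexTorus (siegelPeriodEquiv hδ (neg_map_conj_mem_siegelUpperHalfSpace hZ))}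
    (hh : IsPolarizedIso (siegelPeriodEquiv hδ hZ) (siegelForm hδ hZ)
      (siegelPeriodEquiv hδ (neg_map_conj_mem_siegelUpperHalfSpace hZ))
      (siegelForm hδ (neg_map_conj_mem_siegelUpperHalfSpace hZ)) h) :
    Nonempty (RealStructure 𝓘(ℂ, Fin g → ℂ) (ComplexTorus (siegelPeriodEquiv hδ hZ))) :=
  nonempty_realStructure_of_isIsomorphic_negConj_of_odd hδ hZ hodd hEnd hh.isIsomorphic

/-- **Odd genus, `End(X_Z)^* = {±1}`: `X_Z` is real iff `X_Z ≅ X_{−Z̄}`** — at the archimedean place,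
«model over `ℝ`» ⟺ «field of moduli `⊂ ℝ`» for generic odd-dimensional principally polarized tori.
[cite: Shimura1972FieldOfRationality, Thm. 1, p. 173; §3 Prop. 12 proof, p. 176] -/
theorem nonempty_realStructure_iff_isIsomorphic_negConj_of_odd (hodd : Odd g)
    (hEnd : ∀ P : Matrix (Fin g ⊕ Fin g) (Fin g ⊕ Fin g) ℤ,
      MDifferentiable 𝓘(ℂ, Fin g → ℂ) 𝓘(ℂ, Fin g → ℂ)
          (mapMatrix (siegelPeriodEquiv hδ hZ) (siegelPeriodEquiv hδ hZ) P) →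
        (∃ Q : Matrix (Fin g ⊕ Fin g) (Fin g ⊕ Fin g) ℤ, P * Q = 1 ∧ Q * P = 1) → P = 1 ∨ P = -1) :
    Nonempty (RealStructure 𝓘(ℂ, Fin g → ℂ) (ComplexTorus (siegelPeriodEquiv hδ hZ))) ↔
      IsIsomorphic (siegelPeriodEquiv hδ hZ)
        (siegelPeriodEquiv hδ (neg_map_conj_mem_siegelUpperHalfSpace hZ)) :=
  ⟨fun ⟨S⟩ ↦ isIsomorphic_negConj_of_realStructure hδ hZ S,
    nonempty_realStructure_of_isIsomorphic_negConj_of_odd hδ hZ hodd hEnd⟩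

/-- **No `λ^ρ ∘ λ = −1` in odd genus**: for `g` odd and `End(X_Z)^* = {±1}`, every integral `T`
invertible over `ℤ` whose real action anti-commutes with the complex structure `J_Z` (an
anti-holomorphic lattice automorphism of `X_Z`, e.g. Shimura's `σ⁻¹λ`) satisfies `T² = 1`.
[cite: Shimura1972FieldOfRationality, Thm. 1, p. 173; §3 Prop. 10 («`λ^ρ ∘ λ = −1`», even `n`), p. 174] -/
theorem mul_self_eq_one_of_anticomm_siegel_of_odd (hodd : Odd g)
    (hEnd : ∀ P : Matrix (Fin g ⊕ Fin g) (Fin g ⊕ Fin g) ℤ,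
      MDifferentiable 𝓘(ℂ, Fin g → ℂ) 𝓘(ℂ, Fin g → ℂ)
          (mapMatrix (siegelPeriodEquiv hδ hZ) (siegelPeriodEquiv hδ hZ) P) →
        (∃ Q : Matrix (Fin g ⊕ Fin g) (Fin g ⊕ Fin g) ℤ, P * Q = 1 ∧ Q * P = 1) → P = 1 ∨ P = -1)
    {T T' : Matrix (Fin g ⊕ Fin g) (Fin g ⊕ Fin g) ℤ}
    (hT : ∀ x, T.map (Int.cast : ℤ → ℝ) *ᵥ latticeJ (siegelPeriodEquiv hδ hZ) x =
      -latticeJ (siegelPeriodEquiv hδ hZ) (T.map (Int.cast : ℤ → ℝ) *ᵥ x))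
    (hTT' : T * T' = 1) (hT'T : T' * T = 1) : T * T = 1 := by
  have hodd' : Odd (Module.finrank ℂ (Fin g → ℂ)) := by rwa [Module.finrank_fin_fun]
  exact mul_self_eq_one_of_anticomm_of_odd hodd' hEnd hT hTT' hT'T

end SiegelModuli

end Literature.AlgebraicGeometry.ModuliOfAbelianVarieties
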